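import Mathlib

/-!
# RUNG V5 (`J₅`), brick B7/HP₂ — descent of automorphisms to `(k[x] ⧸ I)[1/ι]`

Sub-problem `ResolutionOfSingularities`, crux `WildQuotients.WildQuotientResolution`
(stmt-ResolutionOfSingularities-15640), line L1 W4.5c, scaffold
`JordanFive.jordanFive_hasResolution_of_bricks` (p527978), brick `HP₂` (res-L1-w45c-plan-1 RULING
10:50Z; card `mu2-strata-kl-twice` of res-L1-w45c-idea-2).  Mathlib-only plumbing for the
twisted-root cover `U₂ = (k[s, Y, pass] ⧸ (Φ))[1/î]`, stated for an arbitrary localisation `U` of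
`k[x] ⧸ I` away from `ι` (`IsLocalization.Away`, so that it applies to section rings of the
geometric side as well as to `Localization.Away`):

* `away_quotient_algHom_ext` — a `k`-algebra map out of `U` is determined on the variables;
* `away_quotient_adjoin_eq_top` — `U` is generated by the variables and `1/ι`;
* `away_quotient_finiteType`, `away_quotient_isDomain`, `algebraMap_mk_eq_zero_iff`;
* `cover_apply_algebraMap_mk`, `cover_pow_apply_algebraMap_mk`, `cover_pow_eq_one_of` — if
  `σ_U ∘ π = π ∘ σ_A` on the variables then everywhere, for all iterates, and `σ_Aᵐ = 1 ⇒ σ_Uᵐ = 1`;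
* `exists_cover_algEquiv_away` — a `k`-automorphism of `k[x]` with `σ(I) = I`, `σ ι = ι` descends
  to a `k`-automorphism of `U`.
-/

-- single-problem summit: the doubled namespace component `ResolutionOfSingularities` is forced
set_option linter.dupNamespace false

noncomputable section

open MvPolynomial

namespace Summit.ResolutionOfSingularities.ResolutionOfSingularities.Theorems.WildQuotientResolution.JordanFive

/-! ## Localisations of quotients of `k[x]`: extensionality, generation, finiteness -/

section AwayQuotient

variable (k : Type) [Field k] (n : ℕ) (I : Ideal (MvPolynomial (Option (Fin n)) k))
  (ι : MvPolynomial (Option (Fin n)) k) (U : Type) [CommRing U]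
  [Algebra (MvPolynomial (Option (Fin n)) k ⧸ I) U] [IsLocalization.Away (Ideal.Quotient.mk I ι) U]
  [Algebra k U] [IsScalarTower k (MvPolynomial (Option (Fin n)) k ⧸ I) U]

/-- `π (C r) = r` for `π : k[x] → k[x] ⧸ I → U`. [folklore] -/
theorem algebraMap_mk_C (r : k) :
    algebraMap _ U (Ideal.Quotient.mk I (C r : MvPolynomial (Option (Fin n)) k)) =
      algebraMap k U r := by
  rw [← MvPolynomial.algebraMap_eq, Ideal.Quotient.mk_algebraMap,
    ← IsScalarTower.algebraMap_apply]

include ι in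
/-- **A `k`-algebra map out of `U = (k[x] ⧸ I)[1/ι]` is determined by the images of the
variables.** [folklore] -/
theorem away_quotient_algHom_ext {T : Type*} [CommRing T] [Algebra k T] {f g : U →ₐ[k] T}
    (h : ∀ o, f (algebraMap _ U (Ideal.Quotient.mk I (X o))) =
      g (algebraMap _ U (Ideal.Quotient.mk I (X o)))) : f = g := by
  apply AlgHom.coe_ringHom_injective
  refine IsLocalization.ringHom_ext (Submonoid.powers (Ideal.Quotient.mk I ι)) ?_
  refine Ideal.Quotient.ringHom_ext ?_
  refine MvPolynomial.ringHom_ext (fun r => ?_) (fun o => ?_)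
  · change f (algebraMap _ U (Ideal.Quotient.mk I (C r))) =
      g (algebraMap _ U (Ideal.Quotient.mk I (C r)))
    rw [algebraMap_mk_C, AlgHom.commutes, AlgHom.commutes]
  · exact h o

/-- **`U = (k[x] ⧸ I)[1/ι]` is generated over `k` by the variables and `1/ι`.** [folklore] -/
theorem away_quotient_adjoin_eq_top :
    Algebra.adjoin k (Set.range (fun o => algebraMap _ U (Ideal.Quotient.mk I (X o))) ∪
      {IsLocalization.Away.invSelf (Ideal.Quotient.mk I ι)}) = ⊤ := by
  rw [eq_top_iff]
  rintro u -
  have hπ : ∀ x : MvPolynomial (Option (Fin n)) k, algebraMap _ U (Ideal.Quotient.mk I x) ∈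
      Algebra.adjoin k (Set.range (fun o => algebraMap _ U (Ideal.Quotient.mk I (X o))) ∪
        {IsLocalization.Away.invSelf (Ideal.Quotient.mk I ι)}) := by
    intro x
    induction x using MvPolynomial.induction_on with
    | C r => rw [algebraMap_mk_C]; exact Subalgebra.algebraMap_mem _ r
    | add p q hp hq => rw [map_add, map_add]; exact add_mem hp hq
    | mul_X p o hp =>
      rw [map_mul, map_mul]
      exact mul_mem hp (Algebra.subset_adjoin (Or.inl ⟨o, rfl⟩))
  obtain ⟨⟨x, m⟩, hxm⟩ := IsLocalization.surj (Submonoid.powers (Ideal.Quotient.mk I ι)) u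
  obtain ⟨j, hj⟩ := m.2
  obtain ⟨x, rfl⟩ := Ideal.Quotient.mk_surjective x
  have hinv : algebraMap _ U (m : MvPolynomial (Option (Fin n)) k ⧸ I) *
      IsLocalization.Away.invSelf (Ideal.Quotient.mk I ι) ^ j = 1 := by
    rw [← hj, map_pow, ← mul_pow, IsLocalization.Away.mul_invSelf, one_pow]
  have hu : u = algebraMap _ U (Ideal.Quotient.mk I x) *
      IsLocalization.Away.invSelf (Ideal.Quotient.mk I ι) ^ j := by
    calc u = u * (algebraMap _ U (m : MvPolynomial (Option (Fin n)) k ⧸ I) *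
          IsLocalization.Away.invSelf (Ideal.Quotient.mk I ι) ^ j) := by rw [hinv, mul_one]
      _ = u * algebraMap _ U (m : MvPolynomial (Option (Fin n)) k ⧸ I) *
          IsLocalization.Away.invSelf (Ideal.Quotient.mk I ι) ^ j := by rw [mul_assoc]
      _ = _ := by rw [hxm]
  rw [hu]
  refine mul_mem (hπ x) (pow_mem ?_ j)
  exact Algebra.subset_adjoin (Or.inr rfl)

include I ι in
/-- `U = (k[x] ⧸ I)[1/ι]` is of finite type over `k`. [folklore] -/
theorem away_quotient_finiteType : Algebra.FiniteType k U :=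
  have hBU : Algebra.FiniteType (MvPolynomial (Option (Fin n)) k ⧸ I) U :=
    IsLocalization.finiteType_of_monoid_fg (M := Submonoid.powers (Ideal.Quotient.mk I ι)) (S := U)
  Algebra.FiniteType.trans (S := MvPolynomial (Option (Fin n)) k ⧸ I) inferInstance hBU

omit [Algebra k U] [IsScalarTower k (MvPolynomial (Option (Fin n)) k ⧸ I) U] in
/-- `U = (k[x] ⧸ I)[1/ι]` is a domain when `k[x] ⧸ I` is and `ι ∉ I`. [folklore] -/
theorem away_quotient_isDomain [IsDomain (MvPolynomial (Option (Fin n)) k ⧸ I)] (hι : ι ∉ I) :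
    IsDomain U :=
  IsLocalization.isDomain_of_le_nonZeroDivisors U (M := Submonoid.powers (Ideal.Quotient.mk I ι))
    (powers_le_nonZeroDivisors_of_noZeroDivisors
      (by rwa [Ne, Ideal.Quotient.eq_zero_iff_mem]))

omit [Algebra k U] [IsScalarTower k (MvPolynomial (Option (Fin n)) k ⧸ I) U] in
/-- When `k[x] ⧸ I` is a domain and `ι ∉ I`, `π x = 0` in `U` iff `x ∈ I`. [folklore] -/
theorem algebraMap_mk_eq_zero_iff [IsDomain (MvPolynomial (Option (Fin n)) k ⧸ I)] (hι : ι ∉ I)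
    (x : MvPolynomial (Option (Fin n)) k) :
    algebraMap _ U (Ideal.Quotient.mk I x) = 0 ↔ x ∈ I := by
  rw [← Ideal.Quotient.eq_zero_iff_mem, ← map_zero (algebraMap (MvPolynomial (Option (Fin n)) k ⧸ I) U)]
  refine ⟨fun h => ?_, fun h => by rw [h]⟩
  exact IsLocalization.injective U (M := Submonoid.powers (Ideal.Quotient.mk I ι))
    (powers_le_nonZeroDivisors_of_noZeroDivisors (by rwa [Ne, Ideal.Quotient.eq_zero_iff_mem])) h

/-! ## Descent of automorphisms of `k[x]` to `(k[x] ⧸ I)[1/ι]` -/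

omit [IsLocalization.Away (Ideal.Quotient.mk I ι) U] in
/-- **The laws determine `σ_U` on `π(k[x])`**: if `σ_U ∘ π` and `π ∘ σ_A` agree on the variables
then `σ_U (π x) = π (σ_A x)` for all `x`. [folklore] -/
theorem cover_apply_algebraMap_mk (σU : U ≃ₐ[k] U)
    (σA : MvPolynomial (Option (Fin n)) k ≃ₐ[k] MvPolynomial (Option (Fin n)) k)
    (h : ∀ o, σU (algebraMap _ U (Ideal.Quotient.mk I (X o))) =
      algebraMap _ U (Ideal.Quotient.mk I (σA (X o))))
    (x : MvPolynomial (Option (Fin n)) k) :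
    σU (algebraMap _ U (Ideal.Quotient.mk I x)) = algebraMap _ U (Ideal.Quotient.mk I (σA x)) := by
  let π : MvPolynomial (Option (Fin n)) k →ₐ[k] U :=
    (IsScalarTower.toAlgHom k (MvPolynomial (Option (Fin n)) k ⧸ I) U).comp
      (Ideal.Quotient.mkₐ k I)
  have key : (σU : U →ₐ[k] U).comp π = π.comp (σA : MvPolynomial (Option (Fin n)) k →ₐ[k] _) :=
    MvPolynomial.algHom_ext (fun o => h o)
  exact DFunLike.congr_fun key x

omit [IsLocalization.Away (Ideal.Quotient.mk I ι) U] in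
/-- Iterates: `σ_Uᵐ (π x) = π (σ_Aᵐ x)`. [folklore] -/
theorem cover_pow_apply_algebraMap_mk (σU : U ≃ₐ[k] U)
    (σA : MvPolynomial (Option (Fin n)) k ≃ₐ[k] MvPolynomial (Option (Fin n)) k)
    (h : ∀ o, σU (algebraMap _ U (Ideal.Quotient.mk I (X o))) =
      algebraMap _ U (Ideal.Quotient.mk I (σA (X o))))
    (m : ℕ) (x : MvPolynomial (Option (Fin n)) k) :
    (σU ^ m) (algebraMap _ U (Ideal.Quotient.mk I x)) =
      algebraMap _ U (Ideal.Quotient.mk I ((σA ^ m) x)) := by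
  induction m generalizing x with
  | zero => simp
  | succ m ih =>
    rw [pow_succ, AlgEquiv.mul_apply, pow_succ, AlgEquiv.mul_apply,
      cover_apply_algebraMap_mk k n I U σU σA h x, ih]

include ι in
/-- **`σ_Aᵐ = 1 ⇒ σ_Uᵐ = 1`.** [folklore] -/
theorem cover_pow_eq_one_of (σU : U ≃ₐ[k] U)
    (σA : MvPolynomial (Option (Fin n)) k ≃ₐ[k] MvPolynomial (Option (Fin n)) k)
    (h : ∀ o, σU (algebraMap _ U (Ideal.Quotient.mk I (X o))) =
      algebraMap _ U (Ideal.Quotient.mk I (σA (X o))))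
    (m : ℕ) (hA : σA ^ m = 1) : σU ^ m = 1 := by
  have key : ((σU ^ m : U ≃ₐ[k] U) : U →ₐ[k] U) = AlgHom.id k U :=
    away_quotient_algHom_ext k n I ι U (fun o => by
      rw [AlgHom.id_apply]
      change (σU ^ m) (algebraMap _ U (Ideal.Quotient.mk I (X o))) = _
      rw [cover_pow_apply_algebraMap_mk k n I U σU σA h, hA, AlgEquiv.one_apply])
  ext u
  exact DFunLike.congr_fun key u

/-- **Descent.** A `k`-automorphism `σ_A` of `k[x]` with `σ_A(I) = I` and `σ_A ι = ι` induces a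
`k`-automorphism `σ_U` of `U = (k[x] ⧸ I)[1/ι]` with `σ_U ∘ π = π ∘ σ_A`. [folklore] -/
theorem exists_cover_algEquiv_away
    (σA : MvPolynomial (Option (Fin n)) k ≃ₐ[k] MvPolynomial (Option (Fin n)) k)
    (hI : I = I.map (σA : MvPolynomial (Option (Fin n)) k →+* MvPolynomial (Option (Fin n)) k))
    (hι : σA ι = ι) :
    ∃ σU : U ≃ₐ[k] U, ∀ x, σU (algebraMap _ U (Ideal.Quotient.mk I x)) =
      algebraMap _ U (Ideal.Quotient.mk I (σA x)) := by
  let σB : (MvPolynomial (Option (Fin n)) k ⧸ I) ≃ₐ[k] (MvPolynomial (Option (Fin n)) k ⧸ I) :=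
    Ideal.quotientEquivAlg I I σA hI
  have hσB : ∀ x, σB (Ideal.Quotient.mk I x) = Ideal.Quotient.mk I (σA x) := fun x => rfl
  have H : Submonoid.map σB (Submonoid.powers (Ideal.Quotient.mk I ι)) =
      Submonoid.powers (Ideal.Quotient.mk I ι) := by
    rw [Submonoid.map_powers, hσB, hι]
  refine ⟨IsLocalization.algEquivOfAlgEquiv (M := Submonoid.powers (Ideal.Quotient.mk I ι))
    (T := Submonoid.powers (Ideal.Quotient.mk I ι)) U U σB H, fun x => ?_⟩
  rw [IsLocalization.algEquivOfAlgEquiv_eq, hσB]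

end AwayQuotient

end Summit.ResolutionOfSingularities.ResolutionOfSingularities.Theorems.WildQuotientResolution.JordanFive

end
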